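import Summits.BirchSwinnertonDyer.BirchSwinnertonDyer.Theorems.PrintCf2DisegniPairTwoChiLinePointwise
import Literature.NumberTheory.EllipticCurves.Disegni2017.ChiLineGrossZagier
import HarnessLib

/-!
# Road (C) `disegni-pair-two` on crux stmt-BirchSwinnertonDyer-20368 — the ARCHIMEDEAN clause of Disegni's
# Thm B ÷ YZZ (1.1.3) on the `ε∘N`-line reads `L′(W,1)·L(W′,1)` (Artin formalism + modularity, by name)

Cell `bsd-print-cf2` (`run/shared/lean/pub/bsd-print-cf2/`), width seat `bsd-line-cf2-p1-w8` g22.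
`--supports stmt-BirchSwinnertonDyer-20368` (helper). THEOREMS ONLY (no `def`, no named fact, no `sorry`);
conditional on the displayed hypotheses (modularity continuation `hasEntireLFunction_rat` as a named-fact
hypothesis, the newforms of the member and of the companion with their coefficient relations). BSD is not
proved by any of this; no summit statement is claimed; 20368 is not closed here.

## What is proved

`Disegni2017.ChiArchRatioClause K V H f χ_H Car G χ y₁ y₂ q` quantifies over EVERY entire continuation `Λ` of
`rankinSelbergEulerProductHecke f χ_H` from `re s > 2`. At the road-(C) point `χ_H = ε∘N_{K/ℚ}`
(`baseChangeDirichlet K ε`, `ε` primitive of `2`-power conductor: `χ₋₄`, `χ₈`, `χ₋₈`), `K` quadratic with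
`(2, d_K) = 1` and Kronecker character `κ`, the Artin formalism (tree theorem
`rankinSelbergEulerProductHecke_baseChangeDirichlet_eq_holds`, packaged by the `g21` file
`PrintCf2DisegniPairTwoChiLinePointwise` as `rankinSelberg_baseChangeDirichlet_eq_mul`) says that
`Λ(s) := L(W, s)·L(W′, s)` IS such a continuation, where `W`, `W′` are curves whose newforms are `f ⊗ ε` and
`f′ ⊗ ε` (`a_n(g) = ε(n)a_n(f)`, `a_n(g′) = ε(n)a_n(f′)`, `a_n(f′) = κ(n)a_n(f)`) and `L(W, ·) =
W.entireLFunction` (modularity continuation). Hence: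

* `entireLFunction_eq_twistedLSeries` — `IsNewformOf W g`, `a_n(g) = ε(n)a_n(f)` ⟹ `L(W, s) = L(f⊗ε, s)`
  on `re s > 2`;
* ★ `chiArchRatioClause_apply_entireLFunction` — the clause gives
  `[H:ℚ]⁻¹ · chiHeightPairing V H G χ y₁ y₂ = (q/2) · Car · (L′(W,1)·L(W′,1) + L(W,1)·L′(W′,1))`;
* ★ `chiArchRatioClause_apply_of_entireLFunction_one_eq_zero` — if `L(W,1) = 0` (the member has odd
  analytic rank), `[H:ℚ]⁻¹ · chiHeightPairing … = (q/2) · Car · L′(W,1) · L(W′,1)`.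

With the seam (`exists_rat_chiPairings_eq[_tower]`, files `…ChiPairingSeam[Tower]`) the left side is
`r·ĥ(P)`, so `q = 2r·ĥ(P) / (Car·L′(W,1)·L(W′,1))` BY NAME — the archimedean half of the `q`-cancellation.

References: D. Disegni, Compos. Math. 153 (2017) (1.1.3) [Disegni2017]; B. Gross, in *Heegner points and
Rankin L-series*, MSRI Publ. 49 (2004) §3, §13 (Artin formalism) [Gross2004]; C. Breuil, B. Conrad,
F. Diamond, R. Taylor, JAMS 14 (2001) Thm. A [BreuilConradDiamondTaylor2001].
-/

set_option autoImplicit false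
set_option linter.dupNamespace false

noncomputable section

open scoped Classical MatrixGroups ModularForm NumberField

open CongruenceSubgroup NumberField WeierstrassCurve Literature.NumberTheory.EllipticCurves
  Literature.NumberTheory.EllipticCurves.ModularForms
  Literature.NumberTheory.EllipticCurves.Disegni2017 Literature.NumberTheory.GaloisRepresentations

namespace Summit.BirchSwinnertonDyer.BirchSwinnertonDyer.Theorems.PrintCf2.DisegniPairTwo

section Arch

/-! ### §1 Modularity: `L(W, s) = L(f ⊗ ε, s)` on `re s > 2` for the newform `g = f ⊗ ε` of `W` -/

/-- **`L(W, s) = L(f ⊗ ε, s)` for `re s > 2`** when `g` is the newform of `W` with `a_n(g) = ε(n)·a_n(f)` for all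
`n` and `L(W, ·)` has its (modularity) entire continuation: `W.entireLFunction = W.LSeries = L(g, ·) = L(f⊗ε, ·)`
termwise. [cite: BreuilConradDiamondTaylor2001, Thm. A] -/
theorem entireLFunction_eq_twistedLSeries (hmod : hasEntireLFunction_rat) {N M : ℕ} [NeZero N] [NeZero M]
    {f : CuspForm (Gamma0 N) 2} {g : CuspForm (Gamma0 M) 2} (W : WeierstrassCurve ℚ) [W.IsElliptic]
    (hg : IsNewformOf W g) {m : ℕ} [NeZero m] (ε : DirichletCharacter ℂ m)
    (hgε : ∀ n : ℕ, cuspCoeff g n = ε n * cuspCoeff f n) {s : ℂ} (hs : 2 < s.re) :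
    W.entireLFunction s = twistedLSeries f ε s := by
  have hs' : (3 / 2 : ℝ) < s.re := by linarith
  rw [W.entireLFunction_eq_LSeries (hmod W) hs', ← hg.cuspFormLSeries_eq]
  unfold cuspFormLSeries twistedLSeries
  congr 1
  funext n
  exact hgε n

/-! ### §2 The archimedean clause at the road-(C) point -/

variable (K : Type) [Field K] [NumberField K] [IsGalois ℚ K]

/-- ★ **The archimedean clause of Thm B ÷ YZZ (1.1.3) on the `ε∘N`-line reads the product `L(W,·)·L(W′,·)`.**
`K` quadratic, `(2, d_K) = 1`, Kronecker character `κ`; `f` a newform (`IsNewform0`), `f′` with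
`a_n(f′) = κ(n)a_n(f)`; `ε` primitive mod `2^n`; `W`, `W′/ℚ` elliptic with newforms `g = f⊗ε`, `g′ = f′⊗ε`
(coefficientwise) and modularity continuations. Then `ChiArchRatioClause K V H f (ε∘N) Car G χ y₁ y₂ q` gives
`[H:ℚ]⁻¹ · chiHeightPairing V H G χ y₁ y₂ = (q/2) · Car · (L′(W,1)·L(W′,1) + L(W,1)·L′(W′,1))`
(`L = entireLFunction`). [cite: Disegni2017, (1.1.3) (arXiv v3 PDF p. 4 L35–41)] [cite: Gross2004, §3 (p. 40), §13 (p. 49)] -/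
theorem chiArchRatioClause_apply_entireLFunction (hmod : hasEntireLFunction_rat)
    (h2 : Module.finrank ℚ K = 2) (κ : DirichletCharacter ℂ (NumberField.discr K).natAbs)
    (hκ : ∀ ℓ : ℕ, ℓ.Prime → ℓ ≠ 2 → κ ℓ = (jacobiSym (NumberField.discr K) ℓ : ℂ))
    (hκ2 : κ 2 = if NumberField.discr K % 8 = 1 then 1
        else if NumberField.discr K % 8 = 5 then -1 else 0)
    (hd : Nat.Coprime 2 (NumberField.discr K).natAbs)
    {N N' M M' : ℕ} [NeZero N] [NeZero N'] [NeZero M] [NeZero M']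
    {f : CuspForm (Gamma0 N) 2} {f' : CuspForm (Gamma0 N') 2}
    {g : CuspForm (Gamma0 M) 2} {g' : CuspForm (Gamma0 M') 2}
    (hf : IsNewform0 f) (hV' : ∀ n : ℕ, cuspCoeff f' n = κ (n : ZMod _) * cuspCoeff f n)
    {n : ℕ} [NeZero (2 ^ n)] {ε : DirichletCharacter ℂ (2 ^ n)} (hε : ε.IsPrimitive)
    (W W' : WeierstrassCurve ℚ) [W.IsElliptic] [W'.IsElliptic]
    (hg : IsNewformOf W g) (hg' : IsNewformOf W' g')
    (hgε : ∀ m : ℕ, cuspCoeff g m = ε m * cuspCoeff f m)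
    (hg'ε : ∀ m : ℕ, cuspCoeff g' m = ε m * cuspCoeff f' m)
    {V : WeierstrassCurve ℚ} {H : Type} [Field H] [NumberField H] {Car : ℝ}
    {G : Subgroup (H ≃ₐ[ℚ] H)} {χ : G →* ℂˣ} {y₁ y₂ : (V.baseChange H).toAffine.Point} {q : ℂ}
    (hA : ChiArchRatioClause K V H f (baseChangeDirichlet K ε) Car G χ y₁ y₂ q) :
    ((Module.finrank ℚ H : ℂ))⁻¹ * chiHeightPairing V H G χ y₁ y₂ =
      q / 2 * (Car : ℂ) *
        (deriv W.entireLFunction 1 * W'.entireLFunction 1 +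
          W.entireLFunction 1 * deriv W'.entireLFunction 1) := by
  have hW := W.differentiable_entireLFunction (hmod W)
  have hW' := W'.differentiable_entireLFunction (hmod W')
  -- the product `L(W,·)·L(W′,·)` continues the Rankin–Selberg Euler product (Artin formalism)
  have hcont := rankinSelberg_baseChangeDirichlet_eq_mul K h2 κ hκ hκ2 hd hf hV' hε
    (Λ₁ := W.entireLFunction) (Λ₂ := W'.entireLFunction)
    (fun s hs => entireLFunction_eq_twistedLSeries hmod W hg ε hgε hs)
    (fun s hs => entireLFunction_eq_twistedLSeries hmod W' hg' ε hg'ε hs)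
  have h := hA.eq (Λ := fun s => W.entireLFunction s * W'.entireLFunction s) (hW.mul hW') hcont
  rw [h, show (fun s => W.entireLFunction s * W'.entireLFunction s) =
      W.entireLFunction * W'.entireLFunction from rfl, deriv_mul (hW 1) (hW' 1)]

/-- ★ **Odd analytic rank of the member**: if moreover `L(W, 1) = 0`, the archimedean clause reads
`[H:ℚ]⁻¹ · chiHeightPairing V H G χ y₁ y₂ = (q/2) · Car · L′(W,1) · L(W′,1)` — Disegni's
`L′(1/2, σ_{A,E′} ⊗ χ)` in (1.1.3) is `L′(W,1)·L(W′,1)` for the road-(C) pair.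
[cite: Disegni2017, (1.1.3) (arXiv v3 PDF p. 4 L35–41)] [cite: Gross2004, §3 (p. 40), §13 (p. 49)] -/
theorem chiArchRatioClause_apply_of_entireLFunction_one_eq_zero (hmod : hasEntireLFunction_rat)
    (h2 : Module.finrank ℚ K = 2) (κ : DirichletCharacter ℂ (NumberField.discr K).natAbs)
    (hκ : ∀ ℓ : ℕ, ℓ.Prime → ℓ ≠ 2 → κ ℓ = (jacobiSym (NumberField.discr K) ℓ : ℂ))
    (hκ2 : κ 2 = if NumberField.discr K % 8 = 1 then 1
        else if NumberField.discr K % 8 = 5 then -1 else 0)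
    (hd : Nat.Coprime 2 (NumberField.discr K).natAbs)
    {N N' M M' : ℕ} [NeZero N] [NeZero N'] [NeZero M] [NeZero M']
    {f : CuspForm (Gamma0 N) 2} {f' : CuspForm (Gamma0 N') 2}
    {g : CuspForm (Gamma0 M) 2} {g' : CuspForm (Gamma0 M') 2}
    (hf : IsNewform0 f) (hV' : ∀ n : ℕ, cuspCoeff f' n = κ (n : ZMod _) * cuspCoeff f n)
    {n : ℕ} [NeZero (2 ^ n)] {ε : DirichletCharacter ℂ (2 ^ n)} (hε : ε.IsPrimitive)
    (W W' : WeierstrassCurve ℚ) [W.IsElliptic] [W'.IsElliptic]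
    (hg : IsNewformOf W g) (hg' : IsNewformOf W' g')
    (hgε : ∀ m : ℕ, cuspCoeff g m = ε m * cuspCoeff f m)
    (hg'ε : ∀ m : ℕ, cuspCoeff g' m = ε m * cuspCoeff f' m)
    (hW1 : W.entireLFunction 1 = 0)
    {V : WeierstrassCurve ℚ} {H : Type} [Field H] [NumberField H] {Car : ℝ}
    {G : Subgroup (H ≃ₐ[ℚ] H)} {χ : G →* ℂˣ} {y₁ y₂ : (V.baseChange H).toAffine.Point} {q : ℂ}
    (hA : ChiArchRatioClause K V H f (baseChangeDirichlet K ε) Car G χ y₁ y₂ q) :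
    ((Module.finrank ℚ H : ℂ))⁻¹ * chiHeightPairing V H G χ y₁ y₂ =
      q / 2 * (Car : ℂ) * (deriv W.entireLFunction 1 * W'.entireLFunction 1) := by
  rw [chiArchRatioClause_apply_entireLFunction K hmod h2 κ hκ hκ2 hd hf hV' hε W W' hg hg' hgε hg'ε hA,
    hW1, zero_mul, add_zero]

end Arch

end Summit.BirchSwinnertonDyer.BirchSwinnertonDyer.Theorems.PrintCf2.DisegniPairTwo

end
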